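import Summits.MatrixMultiplication.MatrixMultiplication.Theses.AlgebraicSTPPDichotomy
import Literature.Computability.AlgebraicComplexity.GroupTheoreticMatMulThmBProofs

/-!
# Disproof of `DefinableDesignBarrier` (crux stmt-MatrixMultiplication-7624) — generation 2

Standing adversary file (refuter cdisprove seat, gen 2).  Findings, all `sorry`-free unless marked:

* §0 SHIELD (re-proved; gen 1 had it): `of_two_lt_omega : 2 < ω(ℂ) → DefinableDesignBarrier`
  (CKSU 2005 Thm 5.5, abelian case, tree theorem `CohnKleinbergSzegedyUmans2005_5_5_abelian_holds`,
  with `ε := ω − 2`, `q₀ := 0`), hence `omega_eq_two_of_not : ¬ DefinableDesignBarrier → ω(ℂ) = 2`,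
  `matrixMultiplication_of_not`, `definableKillLink_holds : DefinableKillLink` (support stmt-7628).
  CONSEQUENCE: the crux cannot be refuted short of proving the summit; every counterexample search
  below is therefore a search for STRUCTURE (what a counterexample must look like), not for a kill.
* §1 FRAME BASICS: independence of the three subspaces of a non-degenerate frame block from the TPP
  clause (`indep_of_frame`), weight bound `|A||B||C| ≤ |H|` (tree), rotation of STPP families.
* §2 FULL-FRAME RIGIDITY (new in Lean; hand proofs by cdisprove-7620 FULLBLOCKS.md and this seat):
  over a field with `≥ 5` elements, in ANY STPP family of punctured-subspace frames, two distinct FULL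
  blocks (`V ⊕ W ⊕ U = F^m`, all three non-zero) are cyclic rotations of one another
  (`rotation_of_full`), and there are at most two full blocks (`card_full_le_two`) — every rank `m`,
  every dimension profile.  Engine: pattern `(i,i,k)` read modulo `W_i` + "a vector space over `F`,
  `|F| ≥ 5`, is not a union of four proper subspaces" (Mathlib
  `Submodule.iUnion_ssubset_of_forall_ne_top_of_card_lt`), then the two rotated patterns.
* §2b `rankThreeNoGo_holds : RankThreeNoGo` (route support stmt-7625) as a corollary: in `F^3` a
  non-degenerate block is full (`sup_sup_eq_top_rank_three`, finrank count), so `card_full_le_two`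
  applies.  Candidate proof for a prover (standard axioms).
* §3 CONSEQUENCE FOR THE CRUX (new): `fullFrameDesigns_admissible` — a frame family all of whose
  positive-weight blocks are full obeys `Σ (|A||B||C|)^{(2+ε)/3} ≤ |F|^m` for EVERY `ε < 1` once
  `|F| ≥ q₀(m, ε)`; no definability, no bound on the index set.  With gen 1's `false_at_one` (the
  definable CKSU two-block family kills `ε = 1`) this pins the full-frame layer exactly at `ε = 1`:
  full frames can never certify anything below `ε = 1`, in particular gen 1's proposed "cheapest
  sub-1 target (m,d,e) = (6,2,1) ↦ 1/2" (q blocks of full plane-triples in `F^6`) is DEAD, and so is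
  every numerology `(3d; d,d,d; e ≥ 1)`.
* §3b `sum_rpow_le_of_sparse`: the numerology lemma (`≤ K q^e` blocks of weight `≤ L q^v` and
  `e + v(2+ε)/3 < m` ⇒ inequality for `q ≥ q₀`) — the formal core of the census.
* §4 WHERE A SUB-1 CERTIFICATE COULD STILL LIVE (doc-comment census, end of file).

Gen-1 content NOT re-proved here (still valid, evidence file `20260815T223646Z-Disproof.lean` on the
item: `fixed_char`, `sum_rpow_two_thirds_le` (ε = 0 endpoint), `false_with_TPP_only`,
`false_without_STPP`, `DefinableDesignBarrierAt`/`at_mono`/`false_at_one`/`false_at_of_one_le`,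
`bounded_index_admissible`, `packing_defect_admissible`).
-/

set_option linter.dupNamespace false

namespace Summit.MatrixMultiplication.MatrixMultiplication.Cruxes.DefinableDesignBarrier.Disproof

open Summit.MatrixMultiplication.MatrixMultiplication.Theses.AlgebraicSTPPDichotomy
open Literature.Computability.AlgebraicComplexity

/-! ## §0 The shield: `¬ crux → ω(ℂ) = 2` -/

/-- If `ω(ℂ) > 2` the crux holds, for ALL STPP families (definability, parameters and `q₀` unused):
CKSU 2005 Thm 5.5 (abelian, tree theorem) with `ε := ω − 2`. -/
theorem of_two_lt_omega (h : 2 < omega ℂ) : DefinableDesignBarrier := by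
  intro e m k φI φA φB φC
  refine ⟨omega ℂ - 2, sub_pos.2 h, 0, ?_⟩
  intro F _ _ _ _ y I A B C _ _ _ _ hS
  classical
  set N := I.card with hN
  let ι : Fin N → (Fin e → F) := fun i => (I.equivFin.symm i : Fin e → F)
  have hι : Function.Injective ι := fun i j hij =>
    I.equivFin.symm.injective (Subtype.ext hij)
  have hιmem : ∀ i, ι i ∈ I := fun i => (I.equivFin.symm i).2
  have hST := hS N ι hι hιmem
  have h55 := CohnKleinbergSzegedyUmans2005_5_5_abelian_holds (Fin m → F) N
    (fun i => A (ι i)) (fun i => B (ι i)) (fun i => C (ι i)) hST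
  have hcard : (Fintype.card (Fin m → F) : ℝ) = (Fintype.card F : ℝ) ^ m := by
    rw [Fintype.card_fun, Fintype.card_fin]; push_cast; rfl
  have hexp : (2 + (omega ℂ - 2)) / 3 = omega ℂ / 3 := by ring
  rw [hexp, ← hcard]
  have hsum : ∑ x ∈ I, (((A x).card * (B x).card * (C x).card : ℕ) : ℝ) ^ (omega ℂ / 3)
      = ∑ i : Fin N, (((A (ι i)).card * (B (ι i)).card * (C (ι i)).card : ℕ) : ℝ) ^
          (omega ℂ / 3) := by
    rw [← Finset.sum_coe_sort]
    exact Fintype.sum_equiv I.equivFin _ _ (fun x => by simp [ι])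
  rw [hsum]
  exact h55

/-- Hence a refutation of the crux is a proof of `ω(ℂ) = 2`. -/
theorem omega_eq_two_of_not (h : ¬ DefinableDesignBarrier) : omega ℂ = 2 := by
  by_contra hne
  exact h (of_two_lt_omega (lt_of_le_of_ne (omega_two_le ℂ) (Ne.symm hne)))

/-- … i.e. a proof of the summit. -/
theorem matrixMultiplication_of_not (h : ¬ DefinableDesignBarrier) : _root_.MatrixMultiplication :=
  (_root_.MatrixMultiplication_iff).2 (omega_eq_two_of_not h)

/-- The support item `DefinableKillLink` (stmt-7628) holds (its CKSU hypothesis is even unused,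
being a tree theorem). Candidate proof for a prover to land. -/
theorem definableKillLink_holds : DefinableKillLink := fun _ h => matrixMultiplication_of_not h

/-! ## §1 Frame basics -/

section Frames

variable {F : Type*} [Field F] {E : Type*} [AddCommGroup E] [Module F E] {N : ℕ}

/-- A field with at least three elements has an element outside `{0, -1}`. -/
theorem exists_ne_zero_ne_neg_one [Fintype F] (hq : 3 ≤ Fintype.card F) :
    ∃ t : F, t ≠ 0 ∧ t ≠ -1 := by
  classical
  by_contra h
  push Not at h
  have hsub : (Finset.univ : Finset F) ⊆ {0, -1} := by
    intro t _
    rcases eq_or_ne t 0 with rfl | ht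
    · simp
    · simp [h t ht]
  have h1 := Finset.card_le_card hsub
  rw [Finset.card_univ] at h1
  have h2 : ({0, -1} : Finset F).card ≤ 2 := Finset.card_le_two
  omega

/-- Every element of a non-zero subspace is a difference of two NON-ZERO elements (`|F| ≥ 3`). -/
theorem exists_sub_eq [Fintype F] (hq : 3 ≤ Fintype.card F) {X : Submodule F E} (hX : X ≠ ⊥)
    {v : E} (hv : v ∈ X) : ∃ s ∈ X, ∃ s' ∈ X, s ≠ 0 ∧ s' ≠ 0 ∧ s' - s = v := by
  rcases eq_or_ne v 0 with rfl | hv0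
  · obtain ⟨y, hy, hy0⟩ := Submodule.exists_mem_ne_zero_of_ne_bot hX
    exact ⟨y, hy, y, hy, hy0, hy0, sub_self y⟩
  · obtain ⟨t, ht0, ht1⟩ := exists_ne_zero_ne_neg_one hq
    refine ⟨t • v, X.smul_mem t hv, (1 + t) • v, X.smul_mem _ hv, smul_ne_zero ht0 hv0, ?_, ?_⟩
    · refine smul_ne_zero ?_ hv0
      intro h
      exact ht1 (eq_neg_of_add_eq_zero_right h)
    · rw [add_smul, one_smul]; abel

/-- **Independence of a non-degenerate frame block.** If `A = V ∖ 0`, `B = W ∖ 0`, `C = U ∖ 0`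
occur as one block of an STPP family and `V, W, U ≠ 0` (`|F| ≥ 3`), then `V ⊕ W ⊕ U` is direct:
`v + w + u = 0` forces `v = w = u = 0` (the TPP clause `i = j = k` of `IsSTPP`). -/
theorem indep_of_frame [Fintype F] (hq : 3 ≤ Fintype.card F)
    {V W U : Fin N → Submodule F E} {A B C : Fin N → Finset E}
    (hA : ∀ i v, v ∈ A i ↔ v ∈ V i ∧ v ≠ 0) (hB : ∀ i v, v ∈ B i ↔ v ∈ W i ∧ v ≠ 0)
    (hC : ∀ i v, v ∈ C i ↔ v ∈ U i ∧ v ≠ 0) (hS : IsSTPP A B C) (i : Fin N)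
    (hV : V i ≠ ⊥) (hW : W i ≠ ⊥) (hU : U i ≠ ⊥) {v w u : E} (hv : v ∈ V i) (hw : w ∈ W i)
    (hu : u ∈ U i) (h0 : v + w + u = 0) : v = 0 ∧ w = 0 ∧ u = 0 := by
  obtain ⟨s, hs, s', hs', hs0, hs0', rfl⟩ := exists_sub_eq hq hV hv
  obtain ⟨t, ht, t', ht', ht0, ht0', rfl⟩ := exists_sub_eq hq hW hw
  obtain ⟨x, hx, x', hx', hx0, hx0', rfl⟩ := exists_sub_eq hq hU hu
  obtain ⟨-, -, h1, h2, h3⟩ := hS i i i s ((hA i s).2 ⟨hs, hs0⟩) s' ((hA i s').2 ⟨hs', hs0'⟩)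
    t ((hB i t).2 ⟨ht, ht0⟩) t' ((hB i t').2 ⟨ht', ht0'⟩) x ((hC i x).2 ⟨hx, hx0⟩)
    x' ((hC i x').2 ⟨hx', hx0'⟩) h0
  subst h1 h2 h3
  simp

/-- Rotation `(A,B,C) ↦ (B,C,A)` preserves `IsSTPP` (tree: `AddSimultaneousTPP.rotate`). -/
theorem isSTPP_rotate {H : Type*} [AddCommGroup H] {A B C : Fin N → Finset H} (hS : IsSTPP A B C) :
    IsSTPP B C A :=
  (isSTPP_iff_addSimultaneousTPP B C A).2 ((isSTPP_iff_addSimultaneousTPP A B C).1 hS).rotate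

/-- "Not a union of `n` proper subspaces" in the form used below: if a subspace `R` is covered by
`n < |F|` subspaces then it lies in one of them (Mathlib
`Submodule.iUnion_ssubset_of_forall_ne_top_of_card_lt`, applied inside `R`). -/
theorem exists_le_of_subset_iUnion [Fintype F] {n : ℕ} (hn : n < Fintype.card F)
    (R : Submodule F E) (P : Fin n → Submodule F E) (h : (R : Set E) ⊆ ⋃ j, (P j : Set E)) :
    ∃ j, R ≤ P j := by
  classical
  by_contra hcon
  push Not at hcon
  have h1 : ∀ j, (P j).comap R.subtype ≠ ⊤ := fun j => by
    rw [Ne, Submodule.comap_subtype_eq_top]; exact hcon j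
  have h2 : ((Finset.univ : Finset (Fin n)).card : ℕ∞) < ENat.card F := by
    rw [Finset.card_univ, Fintype.card_fin, ENat.card_eq_coe_fintype_card]
    exact_mod_cast hn
  have hss := Submodule.iUnion_ssubset_of_forall_ne_top_of_card_lt Finset.univ _ h1 h2
  refine hss.ne ?_
  ext x
  simp only [Finset.mem_univ, Set.iUnion_true, Set.mem_iUnion, SetLike.mem_coe,
    Submodule.mem_comap, Submodule.subtype_apply, Set.mem_univ, iff_true]
  simpa [Set.mem_iUnion] using h x.2

/-- In an independent triple, `(V + W) ∩ (W + U) = W` (the inclusion we need). -/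
theorem mem_mid_of_mem_sup_of_mem_sup {V W U : Submodule F E}
    (hind : ∀ v ∈ V, ∀ w ∈ W, ∀ u ∈ U, v + w + u = 0 → v = 0 ∧ w = 0 ∧ u = 0)
    {x : E} (h1 : x ∈ V ⊔ W) (h2 : x ∈ W ⊔ U) : x ∈ W := by
  obtain ⟨v, hv, w, hw, rfl⟩ := Submodule.mem_sup.1 h1
  obtain ⟨w', hw', u, hu, he⟩ := Submodule.mem_sup.1 h2
  have h0 : v + (w - w') + (-u) = 0 := by
    have : v + (w - w') + (-u) = (v + w) - (w' + u) := by abel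
    rw [this, he, sub_self]
  obtain ⟨hv0, -, -⟩ := hind v hv (w - w') (W.sub_mem hw hw') (-u) (U.neg_mem hu) h0
  rw [hv0, zero_add]
  exact hw

/-- In an independent triple with `U ≠ 0`, `V + W` is a proper subspace. -/
theorem sup_ne_top_of_indep {V W U : Submodule F E}
    (hind : ∀ v ∈ V, ∀ w ∈ W, ∀ u ∈ U, v + w + u = 0 → v = 0 ∧ w = 0 ∧ u = 0) (hU : U ≠ ⊥) :
    V ⊔ W ≠ ⊤ := by
  intro htop
  obtain ⟨u, hu, hu0⟩ := Submodule.exists_mem_ne_zero_of_ne_bot hU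
  have hu' : u ∈ V ⊔ W := by rw [htop]; exact Submodule.mem_top
  obtain ⟨v, hv, w, hw, he⟩ := Submodule.mem_sup.1 hu'
  have h0 : v + w + (-u) = 0 := by rw [he, add_neg_cancel]
  obtain ⟨-, -, h3⟩ := hind v hv w hw (-u) (U.neg_mem hu) h0
  exact hu0 (neg_eq_zero.1 h3)

/-- In an independent triple with `V ≠ 0`, `V` is not contained in `U` (nor in `W`). -/
theorem not_le_of_indep {V W U : Submodule F E}
    (hind : ∀ v ∈ V, ∀ w ∈ W, ∀ u ∈ U, v + w + u = 0 → v = 0 ∧ w = 0 ∧ u = 0) (hV : V ≠ ⊥) :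
    ¬ V ≤ U ∧ ¬ V ≤ W := by
  obtain ⟨v, hv, hv0⟩ := Submodule.exists_mem_ne_zero_of_ne_bot hV
  constructor
  · intro hle
    have h0 : v + 0 + (-v) = 0 := by abel
    exact hv0 (hind v hv 0 W.zero_mem (-v) (U.neg_mem (hle hv)) h0).1
  · intro hle
    have h0 : v + (-v) + 0 = 0 := by abel
    exact hv0 (hind v hv (-v) (W.neg_mem (hle hv)) 0 U.zero_mem h0).1

/-! ## §2 Full-frame rigidity -/

/-- **Pattern `(i,i,k)` modulo `W_i`.** Let block `i` be full (`V_i + W_i + U_i = E`, `W_i ≠ 0`)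
and block `k ≠ i` non-degenerate.  Then `U_k + V_k ⊆ V_i + W_i` or `U_k + V_k ⊆ W_i + U_i`.
Proof: for `u' ∈ U_k ∖ 0`, `s ∈ V_k ∖ 0` write `u' − s = v + w + u`; if `v ≠ 0 ≠ u` then
`s' := −v ∈ A_i`, `t' − t := −w` (two non-zero elements of `W_i`), `u ∈ C_i` give a vanishing
STPP sum with indices `(i,i,k)`, contradiction; so `u' − s ∈ (V_i+W_i) ∪ (W_i+U_i)`, whence
`U_k + V_k ⊆ U_k ∪ V_k ∪ (V_i+W_i) ∪ (W_i+U_i)` and the four-subspace lemma (`|F| ≥ 5`) concludes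
(`U_k + V_k ⊆ U_k` or `⊆ V_k` contradict independence of block `k`). -/
theorem sup_le_or_of_full [Fintype F] (hq : 5 ≤ Fintype.card F)
    {V W U : Fin N → Submodule F E} {A B C : Fin N → Finset E}
    (hA : ∀ i v, v ∈ A i ↔ v ∈ V i ∧ v ≠ 0) (hB : ∀ i v, v ∈ B i ↔ v ∈ W i ∧ v ≠ 0)
    (hC : ∀ i v, v ∈ C i ↔ v ∈ U i ∧ v ≠ 0) (hS : IsSTPP A B C) {i k : Fin N} (hik : i ≠ k)
    (hWi : W i ≠ ⊥) (hfull : V i ⊔ W i ⊔ U i = ⊤)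
    (hVk : V k ≠ ⊥) (hWk : W k ≠ ⊥) (hUk : U k ≠ ⊥) :
    U k ⊔ V k ≤ V i ⊔ W i ∨ U k ⊔ V k ≤ W i ⊔ U i := by
  have hq3 : 3 ≤ Fintype.card F := le_trans (by norm_num) hq
  have hindk := fun v hv w hw u hu h0 =>
    indep_of_frame hq3 hA hB hC hS k hVk hWk hUk (v := v) (w := w) (u := u) hv hw hu h0
  -- Step 1: the key pointwise statement
  have key : ∀ u' ∈ U k, u' ≠ 0 → ∀ s ∈ V k, s ≠ 0 →
      u' - s ∈ V i ⊔ W i ∨ u' - s ∈ W i ⊔ U i := by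
    intro u' hu' hu'0 s hs hs0
    have hx : u' - s ∈ V i ⊔ W i ⊔ U i := by rw [hfull]; exact Submodule.mem_top
    obtain ⟨y, hy, u, hu, hyu⟩ := Submodule.mem_sup.1 hx
    obtain ⟨v, hv, w, hw, rfl⟩ := Submodule.mem_sup.1 hy
    by_cases hv0 : v = 0
    · right
      rw [← hyu, hv0, zero_add]
      exact Submodule.add_mem _ (Submodule.mem_sup_left hw) (Submodule.mem_sup_right hu)
    by_cases hu0 : u = 0
    · left
      rw [← hyu, hu0, add_zero]
      exact Submodule.add_mem _ (Submodule.mem_sup_left hv) (Submodule.mem_sup_right hw)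
    exfalso
    obtain ⟨t, ht, t', ht', ht0, ht0', htt⟩ := exists_sub_eq hq3 hWi ((W i).neg_mem hw)
    have hsum : (-v - s) + (t' - t) + (u' - u) = 0 := by
      rw [htt]
      have : (-v - s) + (-w) + (u' - u) = (u' - s) - (v + w + u) := by abel
      rw [this, hyu, sub_self]
    obtain ⟨-, hik', -⟩ := hS i i k s ((hA k s).2 ⟨hs, hs0⟩) (-v)
      ((hA i _).2 ⟨(V i).neg_mem hv, neg_ne_zero.2 hv0⟩) t ((hB i t).2 ⟨ht, ht0⟩)
      t' ((hB i t').2 ⟨ht', ht0'⟩) u ((hC i u).2 ⟨hu, hu0⟩) u' ((hC k u').2 ⟨hu', hu'0⟩) hsum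
    exact hik hik'
  -- Step 2: cover `U k ⊔ V k` by four subspaces
  let P : Fin 4 → Submodule F E := ![U k, V k, V i ⊔ W i, W i ⊔ U i]
  have hcover : ((U k ⊔ V k : Submodule F E) : Set E) ⊆ ⋃ j, (P j : Set E) := by
    intro x hx
    obtain ⟨u', hu', s, hs, rfl⟩ := Submodule.mem_sup.1 hx
    simp only [Set.mem_iUnion, SetLike.mem_coe]
    by_cases hu'0 : u' = 0
    · exact ⟨1, by simp [P, hu'0, hs]⟩
    by_cases hs0 : s = 0
    · exact ⟨0, by simp [P, hs0, hu']⟩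
    have hs' : -s ∈ V k := (V k).neg_mem hs
    rcases key u' hu' hu'0 (-s) hs' (neg_ne_zero.2 hs0) with h | h
    · exact ⟨2, by simpa [P, sub_neg_eq_add] using h⟩
    · exact ⟨3, by simpa [P, sub_neg_eq_add] using h⟩
  -- Step 3: the four-subspace lemma
  obtain ⟨j, hj⟩ := exists_le_of_subset_iUnion (lt_of_lt_of_le (by norm_num) hq) _ P hcover
  fin_cases j
  · -- `U k ⊔ V k ≤ U k`: then `V k ≤ U k`, contradicting independence of block `k`
    exfalso
    have hle : V k ≤ U k := by simpa [P] using hj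
    exact (not_le_of_indep hindk hVk).1 hle
  · exfalso
    have hle : U k ≤ V k := by simpa [P] using hj
    obtain ⟨u, hu, hu0⟩ := Submodule.exists_mem_ne_zero_of_ne_bot hUk
    have h0 : u + 0 + (-u) = 0 := by abel
    exact hu0 (hindk u (hle hu) 0 (W k).zero_mem (-u) ((U k).neg_mem hu) h0).1
  · left; simpa [P] using hj
  · right; simpa [P] using hj

/-- The three containments available when block `i` is full and block `k ≠ i` is non-degenerate
(`sup_le_or_of_full` for the family and its two rotations): with `P = V+W`, `Q = W+U`, `R = U+V`,
`R_k ⊆ P_i ∨ R_k ⊆ Q_i`, `P_k ⊆ Q_i ∨ P_k ⊆ R_i`, `Q_k ⊆ R_i ∨ Q_k ⊆ P_i`. -/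
theorem three_containments [Fintype F] (hq : 5 ≤ Fintype.card F)
    {V W U : Fin N → Submodule F E} {A B C : Fin N → Finset E}
    (hA : ∀ i v, v ∈ A i ↔ v ∈ V i ∧ v ≠ 0) (hB : ∀ i v, v ∈ B i ↔ v ∈ W i ∧ v ≠ 0)
    (hC : ∀ i v, v ∈ C i ↔ v ∈ U i ∧ v ≠ 0) (hS : IsSTPP A B C) {i k : Fin N} (hik : i ≠ k)
    (hVi : V i ≠ ⊥) (hWi : W i ≠ ⊥) (hUi : U i ≠ ⊥) (hfull : V i ⊔ W i ⊔ U i = ⊤)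
    (hVk : V k ≠ ⊥) (hWk : W k ≠ ⊥) (hUk : U k ≠ ⊥) :
    (U k ⊔ V k ≤ V i ⊔ W i ∨ U k ⊔ V k ≤ W i ⊔ U i) ∧
    (V k ⊔ W k ≤ W i ⊔ U i ∨ V k ⊔ W k ≤ U i ⊔ V i) ∧
    (W k ⊔ U k ≤ U i ⊔ V i ∨ W k ⊔ U k ≤ V i ⊔ W i) := by
  refine ⟨sup_le_or_of_full hq hA hB hC hS hik hWi hfull hVk hWk hUk, ?_, ?_⟩
  · have hfull' : W i ⊔ U i ⊔ V i = ⊤ := by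
      rw [sup_comm, ← sup_assoc]; exact hfull
    exact sup_le_or_of_full hq hB hC hA (isSTPP_rotate hS) hik hUi hfull' hWk hUk hVk
  · have hfull' : U i ⊔ V i ⊔ W i = ⊤ := by
      rw [sup_assoc, sup_comm]; exact hfull
    exact sup_le_or_of_full hq hC hA hB (isSTPP_rotate (isSTPP_rotate hS)) hik hVi hfull'
      hUk hVk hWk

/-- Two full blocks: the subspaces of block `k` sit INSIDE a rotation of block `i`. -/
theorem le_rotation_of_full [Fintype F] (hq : 5 ≤ Fintype.card F)
    {V W U : Fin N → Submodule F E} {A B C : Fin N → Finset E}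
    (hA : ∀ i v, v ∈ A i ↔ v ∈ V i ∧ v ≠ 0) (hB : ∀ i v, v ∈ B i ↔ v ∈ W i ∧ v ≠ 0)
    (hC : ∀ i v, v ∈ C i ↔ v ∈ U i ∧ v ≠ 0) (hS : IsSTPP A B C) {i k : Fin N} (hik : i ≠ k)
    (hVi : V i ≠ ⊥) (hWi : W i ≠ ⊥) (hUi : U i ≠ ⊥) (hfi : V i ⊔ W i ⊔ U i = ⊤)
    (hVk : V k ≠ ⊥) (hWk : W k ≠ ⊥) (hUk : U k ≠ ⊥) (hfk : V k ⊔ W k ⊔ U k = ⊤) :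
    (V k ≤ W i ∧ W k ≤ U i ∧ U k ≤ V i) ∨ (V k ≤ U i ∧ W k ≤ V i ∧ U k ≤ W i) := by
  have hq3 : 3 ≤ Fintype.card F := le_trans (by norm_num) hq
  have hindi := fun v hv w hw u hu h0 =>
    indep_of_frame hq3 hA hB hC hS i hVi hWi hUi (v := v) (w := w) (u := u) hv hw hu h0
  -- rotated independence statements for block `i`
  have hindi' : ∀ w ∈ W i, ∀ u ∈ U i, ∀ v ∈ V i, w + u + v = 0 → w = 0 ∧ u = 0 ∧ v = 0 := by
    intro w hw u hu v hv h0
    have h := hindi v hv w hw u hu (by rw [← h0]; abel)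
    exact ⟨h.2.1, h.2.2, h.1⟩
  have hindi'' : ∀ u ∈ U i, ∀ v ∈ V i, ∀ w ∈ W i, u + v + w = 0 → u = 0 ∧ v = 0 ∧ w = 0 := by
    intro u hu v hv w hw h0
    have h := hindi v hv w hw u hu (by rw [← h0]; abel)
    exact ⟨h.2.2, h.1, h.2.1⟩
  -- the three big subspaces of block `i` are proper
  have hPi : V i ⊔ W i ≠ ⊤ := sup_ne_top_of_indep hindi hUi
  have hQi : W i ⊔ U i ≠ ⊤ := sup_ne_top_of_indep hindi' hVi
  have hRi : U i ⊔ V i ≠ ⊤ := sup_ne_top_of_indep hindi'' hWi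
  -- two big subspaces of the FULL block `k` cannot sit in one proper subspace
  have htop : ∀ X : Submodule F E, V k ≤ X → W k ≤ X → U k ≤ X → X = ⊤ := fun X h1 h2 h3 =>
    top_le_iff.1 (hfk ▸ sup_le (sup_le h1 h2) h3)
  obtain ⟨h1, h2, h3⟩ := three_containments hq hA hB hC hS hik hVi hWi hUi hfi hVk hWk hUk
  -- `V k ≤ P k ⊓ R k`, `W k ≤ P k ⊓ Q k`, `U k ≤ Q k ⊓ R k`
  rcases h2 with h2 | h2
  · -- `P k ≤ Q i`
    rcases h3 with h3 | h3
    · -- `Q k ≤ R i`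
      rcases h1 with h1 | h1
      · -- `R k ≤ P i`: first rotation
        left
        refine ⟨fun v hv => ?_, fun w hw => ?_, fun u hu => ?_⟩
        · exact mem_mid_of_mem_sup_of_mem_sup hindi (h1 (Submodule.mem_sup_right hv))
            (h2 (Submodule.mem_sup_left hv))
        · exact mem_mid_of_mem_sup_of_mem_sup hindi' (h2 (Submodule.mem_sup_right hw))
            (h3 (Submodule.mem_sup_left hw))
        · exact mem_mid_of_mem_sup_of_mem_sup hindi'' (h3 (Submodule.mem_sup_right hu))
            (h1 (Submodule.mem_sup_left hu))
      · -- `R k ≤ Q i` together with `P k ≤ Q i`: `Q i = ⊤`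
        exact absurd (htop _ (le_trans le_sup_left h2) (le_trans le_sup_right h2)
          (le_trans le_sup_left h1)) hQi
    · -- `Q k ≤ P i`
      rcases h1 with h1 | h1
      · exact absurd (htop _ (le_trans le_sup_right h1) (le_trans le_sup_left h3)
          (le_trans le_sup_left h1)) hPi
      · exact absurd (htop _ (le_trans le_sup_left h2) (le_trans le_sup_right h2)
          (le_trans le_sup_left h1)) hQi
  · -- `P k ≤ R i`
    rcases h3 with h3 | h3
    · -- `Q k ≤ R i` together with `P k ≤ R i`: `R i = ⊤`
      exact absurd (htop _ (le_trans le_sup_left h2) (le_trans le_sup_right h2)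
        (le_trans le_sup_right h3)) hRi
    · -- `Q k ≤ P i`
      rcases h1 with h1 | h1
      · exact absurd (htop _ (le_trans le_sup_right h1) (le_trans le_sup_left h3)
          (le_trans le_sup_right h3)) hPi
      · -- `R k ≤ Q i`: second rotation
        right
        refine ⟨fun v hv => ?_, fun w hw => ?_, fun u hu => ?_⟩
        · exact mem_mid_of_mem_sup_of_mem_sup hindi' (h1 (Submodule.mem_sup_right hv))
            (h2 (Submodule.mem_sup_left hv))
        · exact mem_mid_of_mem_sup_of_mem_sup hindi'' (h2 (Submodule.mem_sup_right hw))
            (h3 (Submodule.mem_sup_left hw))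
        · exact mem_mid_of_mem_sup_of_mem_sup hindi (h3 (Submodule.mem_sup_right hu))
            (h1 (Submodule.mem_sup_left hu))

/-- **Full-frame rigidity, pairwise form.** Over a field with `≥ 5` elements, two distinct FULL
blocks of an STPP frame family are cyclic rotations of each other:
`(V_k, W_k, U_k) = (W_i, U_i, V_i)` or `(U_i, V_i, W_i)`. -/
theorem rotation_of_full [Fintype F] (hq : 5 ≤ Fintype.card F)
    {V W U : Fin N → Submodule F E} {A B C : Fin N → Finset E}
    (hA : ∀ i v, v ∈ A i ↔ v ∈ V i ∧ v ≠ 0) (hB : ∀ i v, v ∈ B i ↔ v ∈ W i ∧ v ≠ 0)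
    (hC : ∀ i v, v ∈ C i ↔ v ∈ U i ∧ v ≠ 0) (hS : IsSTPP A B C) {i k : Fin N} (hik : i ≠ k)
    (hVi : V i ≠ ⊥) (hWi : W i ≠ ⊥) (hUi : U i ≠ ⊥) (hfi : V i ⊔ W i ⊔ U i = ⊤)
    (hVk : V k ≠ ⊥) (hWk : W k ≠ ⊥) (hUk : U k ≠ ⊥) (hfk : V k ⊔ W k ⊔ U k = ⊤) :
    (V k = W i ∧ W k = U i ∧ U k = V i) ∨ (V k = U i ∧ W k = V i ∧ U k = W i) := by
  have hq3 : 3 ≤ Fintype.card F := le_trans (by norm_num) hq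
  have hindk := fun v hv w hw u hu h0 =>
    indep_of_frame hq3 hA hB hC hS k hVk hWk hUk (v := v) (w := w) (u := u) hv hw hu h0
  have hik_cases := le_rotation_of_full hq hA hB hC hS hik hVi hWi hUi hfi hVk hWk hUk hfk
  have hki_cases := le_rotation_of_full hq hA hB hC hS (Ne.symm hik) hVk hWk hUk hfk hVi hWi hUi hfi
  rcases hik_cases with ⟨a1, a2, a3⟩ | ⟨a1, a2, a3⟩ <;> rcases hki_cases with ⟨b1, b2, b3⟩ | ⟨b1, b2, b3⟩
  · -- V k ≤ W i ≤ U k : contradiction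
    exact absurd (le_trans a1 b2) (not_le_of_indep hindk hVk).1
  · exact Or.inl ⟨le_antisymm a1 b2, le_antisymm a2 b3, le_antisymm a3 b1⟩
  · exact Or.inr ⟨le_antisymm a1 b3, le_antisymm a2 b1, le_antisymm a3 b2⟩
  · -- V k ≤ U i ≤ W k : contradiction
    exact absurd (le_trans a1 b3) (not_le_of_indep hindk hVk).2

/-- **Full-frame rigidity: at most two full blocks.**  For every STPP family of punctured-subspace
frames in a vector space over a field with at least `5` elements — any rank, any dimension profile —
at most two blocks are full (`V ⊕ W ⊕ U = E` with `V, W, U ≠ 0`).  (Three full blocks would be the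
three rotations of one decomposition, and those violate the all-distinct STPP pattern:
`(v − u) + (u − w) + (w − v) = 0`.)  The CKSU 2005 §5 example shows `2` is attained for every `m ≥ 3`.
Generalises the route support `RankThreeNoGo` (m = 3) to all ranks. -/
theorem card_full_le_two [Fintype F] (hq : 5 ≤ Fintype.card F)
    {V W U : Fin N → Submodule F E} {A B C : Fin N → Finset E}
    (hA : ∀ i v, v ∈ A i ↔ v ∈ V i ∧ v ≠ 0) (hB : ∀ i v, v ∈ B i ↔ v ∈ W i ∧ v ≠ 0)
    (hC : ∀ i v, v ∈ C i ↔ v ∈ U i ∧ v ≠ 0) (hS : IsSTPP A B C)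
    [DecidablePred fun i => V i ≠ ⊥ ∧ W i ≠ ⊥ ∧ U i ≠ ⊥ ∧ V i ⊔ W i ⊔ U i = ⊤] :
    (Finset.univ.filter fun i => V i ≠ ⊥ ∧ W i ≠ ⊥ ∧ U i ≠ ⊥ ∧ V i ⊔ W i ⊔ U i = ⊤).card ≤ 2 := by
  have hq3 : 3 ≤ Fintype.card F := le_trans (by norm_num) hq
  by_contra hlt
  push Not at hlt
  rw [Finset.two_lt_card_iff] at hlt
  obtain ⟨i, k, l, hi, hk, hl, hik, hil, hkl⟩ := hlt
  simp only [Finset.mem_filter, Finset.mem_univ, true_and] at hi hk hl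
  obtain ⟨hVi, hWi, hUi, hfi⟩ := hi
  obtain ⟨hVk, hWk, hUk, hfk⟩ := hk
  obtain ⟨hVl, hWl, hUl, hfl⟩ := hl
  have hindk := fun v hv w hw u hu h0 =>
    indep_of_frame hq3 hA hB hC hS k hVk hWk hUk (v := v) (w := w) (u := u) hv hw hu h0
  obtain ⟨v₀, hv₀, hv₀0⟩ := Submodule.exists_mem_ne_zero_of_ne_bot hVi
  obtain ⟨w₀, hw₀, hw₀0⟩ := Submodule.exists_mem_ne_zero_of_ne_bot hWi
  obtain ⟨u₀, hu₀, hu₀0⟩ := Submodule.exists_mem_ne_zero_of_ne_bot hUi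
  have hsum : (v₀ - u₀) + (u₀ - w₀) + (w₀ - v₀) = 0 := by abel
  have hk' := rotation_of_full hq hA hB hC hS hik hVi hWi hUi hfi hVk hWk hUk hfk
  have hl' := rotation_of_full hq hA hB hC hS hil hVi hWi hUi hfi hVl hWl hUl hfl
  have hkl' := rotation_of_full hq hA hB hC hS hkl hVk hWk hUk hfk hVl hWl hUl hfl
  rcases hk' with ⟨k1, k2, k3⟩ | ⟨k1, k2, k3⟩ <;> rcases hl' with ⟨l1, l2, l3⟩ | ⟨l1, l2, l3⟩
  · -- same rotation: V k = V l, then `rotation_of_full k l` forces V k = W k or V k = U k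
    rcases hkl' with ⟨m1, -, -⟩ | ⟨m1, -, -⟩
    · exact (not_le_of_indep hindk hVk).2 (le_of_eq (k1.trans (l1.symm.trans m1)))
    · exact (not_le_of_indep hindk hVk).1 (le_of_eq (k1.trans (l1.symm.trans m1)))
  · -- k = ρ i, l = ρ² i : indices (i, k, l)
    obtain ⟨h, -⟩ := hS i k l u₀ ((hA l u₀).2 ⟨l1 ▸ hu₀, hu₀0⟩) v₀ ((hA i v₀).2 ⟨hv₀, hv₀0⟩)
      w₀ ((hB i w₀).2 ⟨hw₀, hw₀0⟩) u₀ ((hB k u₀).2 ⟨k2 ▸ hu₀, hu₀0⟩)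
      v₀ ((hC k v₀).2 ⟨k3 ▸ hv₀, hv₀0⟩) w₀ ((hC l w₀).2 ⟨l3 ▸ hw₀, hw₀0⟩) hsum
    exact hik h
  · -- k = ρ² i, l = ρ i : indices (i, l, k)
    obtain ⟨h, -⟩ := hS i l k u₀ ((hA k u₀).2 ⟨k1 ▸ hu₀, hu₀0⟩) v₀ ((hA i v₀).2 ⟨hv₀, hv₀0⟩)
      w₀ ((hB i w₀).2 ⟨hw₀, hw₀0⟩) u₀ ((hB l u₀).2 ⟨l2 ▸ hu₀, hu₀0⟩)
      v₀ ((hC l v₀).2 ⟨l3 ▸ hv₀, hv₀0⟩) w₀ ((hC k w₀).2 ⟨k3 ▸ hw₀, hw₀0⟩) hsum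
    exact hil h
  · rcases hkl' with ⟨m1, -, -⟩ | ⟨m1, -, -⟩
    · exact (not_le_of_indep hindk hVk).2 (le_of_eq (k1.trans (l1.symm.trans m1)))
    · exact (not_le_of_indep hindk hVk).1 (le_of_eq (k1.trans (l1.symm.trans m1)))

/-- In `F^3` a non-degenerate block of an STPP frame family is automatically full
(`dim V + dim W + dim U ≥ 3` and the sum is direct by `indep_of_frame`). -/
theorem sup_sup_eq_top_rank_three [Fintype F] (hq : 3 ≤ Fintype.card F)
    {V W U : Fin N → Submodule F (Fin 3 → F)} {A B C : Fin N → Finset (Fin 3 → F)}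
    (hA : ∀ i v, v ∈ A i ↔ v ∈ V i ∧ v ≠ 0) (hB : ∀ i v, v ∈ B i ↔ v ∈ W i ∧ v ≠ 0)
    (hC : ∀ i v, v ∈ C i ↔ v ∈ U i ∧ v ≠ 0) (hS : IsSTPP A B C) (i : Fin N)
    (hV : V i ≠ ⊥) (hW : W i ≠ ⊥) (hU : U i ≠ ⊥) : V i ⊔ W i ⊔ U i = ⊤ := by
  have hind := fun v hv w hw u hu h0 =>
    indep_of_frame hq hA hB hC hS i hV hW hU (v := v) (w := w) (u := u) hv hw hu h0
  have h1 : V i ⊓ W i = ⊥ := by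
    rw [Submodule.eq_bot_iff]
    rintro x ⟨hxV, hxW⟩
    exact (hind x hxV (-x) ((W i).neg_mem hxW) 0 (U i).zero_mem (by abel)).1
  have h2 : (V i ⊔ W i) ⊓ U i = ⊥ := by
    rw [Submodule.eq_bot_iff]
    rintro x ⟨hxVW, hxU⟩
    obtain ⟨v, hv, w, hw, rfl⟩ := Submodule.mem_sup.1 hxVW
    obtain ⟨hv0, hw0, -⟩ := hind v hv w hw (-(v + w)) ((U i).neg_mem hxU) (by abel)
    rw [hv0, hw0, add_zero]
  have e1 := Submodule.finrank_sup_add_finrank_inf_eq (V i) (W i)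
  rw [h1, finrank_bot, add_zero] at e1
  have e2 := Submodule.finrank_sup_add_finrank_inf_eq (V i ⊔ W i) (U i)
  rw [h2, finrank_bot, add_zero, e1] at e2
  have hV1 := Submodule.one_le_finrank_iff.2 hV
  have hW1 := Submodule.one_le_finrank_iff.2 hW
  have hU1 := Submodule.one_le_finrank_iff.2 hU
  by_contra hne
  have hlt := Submodule.finrank_lt hne
  rw [Module.finrank_fin_fun] at hlt
  omega

end Frames

/-- **`RankThreeNoGo` (route support stmt-MatrixMultiplication-7625) follows from full-frame
rigidity**: in `F^3`, `|F| ≥ 5`, a block with `A, B, C` non-empty is non-degenerate, hence full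
(`sup_sup_eq_top_rank_three`), and there are at most two full blocks (`card_full_le_two`).
Candidate proof for a prover to land (another candidate, by cdisprove-7623, is on the item). -/
theorem rankThreeNoGo_holds : RankThreeNoGo := by
  intro F _ _ hq N V W U A B C hA hB hC hS
  classical
  have hq3 : 3 ≤ Fintype.card F := le_trans (by norm_num) hq
  refine le_trans (Finset.card_le_card ?_) (card_full_le_two hq hA hB hC hS)
  intro i hi
  simp only [Finset.mem_filter, Finset.mem_univ, true_and] at hi ⊢
  obtain ⟨⟨a, ha⟩, ⟨b, hb⟩, ⟨c, hc⟩⟩ := hi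
  have hV : V i ≠ ⊥ := (Submodule.ne_bot_iff _).2 ⟨a, ((hA i a).1 ha).1, ((hA i a).1 ha).2⟩
  have hW : W i ≠ ⊥ := (Submodule.ne_bot_iff _).2 ⟨b, ((hB i b).1 hb).1, ((hB i b).1 hb).2⟩
  have hU : U i ≠ ⊥ := (Submodule.ne_bot_iff _).2 ⟨c, ((hC i c).1 hc).1, ((hC i c).1 hc).2⟩
  exact ⟨hV, hW, hU, sup_sup_eq_top_rank_three hq3 hA hB hC hS i hV hW hU⟩

/-! ## §3 Consequence for the crux: full-frame designs are admissible at every `ε < 1` -/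

/-- **Full-frame designs certify nothing below `ε = 1`.**  Fix `m ≥ 1` and `0 ≤ ε < 1`.  For all
finite fields `F` with `|F| ≥ q₀(m, ε)` and every STPP family of punctured-subspace frames in `F^m`
whose positive-weight blocks are all FULL (`V_i + W_i + U_i = F^m`), the crux inequality
`Σ_i (|A_i||B_i||C_i|)^{(2+ε)/3} ≤ |F|^m` holds — no definability, no bound on the number of blocks
(rigidity `card_full_le_two` caps the positive-weight blocks at two, each of weight `≤ |F|^m`).
Together with gen 1's `false_at_one` (the definable two-block CKSU family violates `ε = 1`) this pins
the full-frame layer of the crux exactly at `ε = 1`. -/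
theorem fullFrameDesigns_admissible {m : ℕ} (hm : 1 ≤ m) {ε : ℝ} (hε0 : 0 ≤ ε) (hε1 : ε < 1) :
    ∃ q₀ : ℕ, ∀ (F : Type) [Field F] [Fintype F], q₀ ≤ Fintype.card F →
      ∀ (N : ℕ) (V W U : Fin N → Submodule F (Fin m → F)) (A B C : Fin N → Finset (Fin m → F)),
        (∀ i v, v ∈ A i ↔ v ∈ V i ∧ v ≠ 0) → (∀ i v, v ∈ B i ↔ v ∈ W i ∧ v ≠ 0) →
        (∀ i v, v ∈ C i ↔ v ∈ U i ∧ v ≠ 0) → IsSTPP A B C →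
        (∀ i, (A i).Nonempty → (B i).Nonempty → (C i).Nonempty → V i ⊔ W i ⊔ U i = ⊤) →
        ∑ i, (((A i).card * (B i).card * (C i).card : ℕ) : ℝ) ^ ((2 + ε) / 3) ≤
          (Fintype.card F : ℝ) ^ m := by
  set θ : ℝ := m * (1 - ε) / 3 with hθ
  have hθpos : 0 < θ := by
    have : (0 : ℝ) < m := by exact_mod_cast hm
    have : (0 : ℝ) < 1 - ε := by linarith
    positivity
  refine ⟨max 5 (Nat.ceil ((2 : ℝ) ^ (1 / θ))), ?_⟩
  intro F _ _ hq N V W U A B C hA hB hC hS hfullhyp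
  classical
  have hq5 : 5 ≤ Fintype.card F := le_trans (le_max_left _ _) hq
  set q : ℝ := (Fintype.card F : ℝ) with hqdef
  have hqpos : 0 < q := by rw [hqdef]; exact_mod_cast Fintype.card_pos
  have hq2 : (2 : ℝ) ≤ q ^ θ := by
    have h1 : (2 : ℝ) ^ (1 / θ) ≤ q := by
      have : (Nat.ceil ((2 : ℝ) ^ (1 / θ)) : ℝ) ≤ q := by
        rw [hqdef]; exact_mod_cast le_trans (le_max_right _ _) hq
      exact le_trans (Nat.le_ceil _) this
    calc (2 : ℝ) = ((2 : ℝ) ^ (1 / θ)) ^ θ := by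
          rw [← Real.rpow_mul (by norm_num), one_div, inv_mul_cancel₀ hθpos.ne', Real.rpow_one]
      _ ≤ q ^ θ := Real.rpow_le_rpow (by positivity) h1 hθpos.le
  -- the positive-weight blocks
  set S := Finset.univ.filter fun i : Fin N => (A i).Nonempty ∧ (B i).Nonempty ∧ (C i).Nonempty
    with hSdef
  have hsumS : ∑ i, (((A i).card * (B i).card * (C i).card : ℕ) : ℝ) ^ ((2 + ε) / 3) =
      ∑ i ∈ S, (((A i).card * (B i).card * (C i).card : ℕ) : ℝ) ^ ((2 + ε) / 3) := by
    rw [hSdef, Finset.sum_filter_of_ne]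
    intro i _ hne
    by_contra hcon
    apply hne
    have h0 : ((A i).card * (B i).card * (C i).card : ℕ) = 0 := by
      simp only [not_and_or, Finset.not_nonempty_iff_eq_empty] at hcon
      rcases hcon with h | h | h <;> simp [h]
    rw [h0, Nat.cast_zero, Real.zero_rpow]
    have : (0 : ℝ) < (2 + ε) / 3 := by linarith
    exact this.ne'
  -- `S` consists of full blocks, hence `|S| ≤ 2`
  have hSfull : S ⊆ Finset.univ.filter
      fun i => V i ≠ ⊥ ∧ W i ≠ ⊥ ∧ U i ≠ ⊥ ∧ V i ⊔ W i ⊔ U i = ⊤ := by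
    intro i hi
    simp only [hSdef, Finset.mem_filter, Finset.mem_univ, true_and] at hi ⊢
    obtain ⟨⟨a, ha⟩, ⟨b, hb⟩, ⟨c, hc⟩⟩ := hi
    refine ⟨?_, ?_, ?_, hfullhyp i ⟨a, ha⟩ ⟨b, hb⟩ ⟨c, hc⟩⟩
    · exact (Submodule.ne_bot_iff _).2 ⟨a, ((hA i a).1 ha).1, ((hA i a).1 ha).2⟩
    · exact (Submodule.ne_bot_iff _).2 ⟨b, ((hB i b).1 hb).1, ((hB i b).1 hb).2⟩
    · exact (Submodule.ne_bot_iff _).2 ⟨c, ((hC i c).1 hc).1, ((hC i c).1 hc).2⟩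
  have hScard : (S.card : ℝ) ≤ 2 := by
    have := le_trans (Finset.card_le_card hSfull) (card_full_le_two hq5 hA hB hC hS)
    exact_mod_cast this
  -- each term is at most `q^{m(2+ε)/3}` (weight `≤ |F^m|` by the TPP)
  have hS' := (isSTPP_iff_addSimultaneousTPP A B C).1 hS
  have hterm : ∀ i, (((A i).card * (B i).card * (C i).card : ℕ) : ℝ) ^ ((2 + ε) / 3) ≤
      q ^ ((m : ℝ) * ((2 + ε) / 3)) := by
    intro i
    have hw : (((A i).card * (B i).card * (C i).card : ℕ) : ℝ) ≤ q ^ (m : ℝ) := by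
      have h := hS'.card_mul_card_mul_card_le i
      rw [Fintype.card_fun, Fintype.card_fin] at h
      rw [Real.rpow_natCast, hqdef]
      exact_mod_cast h
    calc (((A i).card * (B i).card * (C i).card : ℕ) : ℝ) ^ ((2 + ε) / 3)
        ≤ (q ^ (m : ℝ)) ^ ((2 + ε) / 3) := Real.rpow_le_rpow (by positivity) hw (by linarith)
      _ = q ^ ((m : ℝ) * ((2 + ε) / 3)) := by rw [← Real.rpow_mul hqpos.le]
  rw [hsumS]
  calc ∑ i ∈ S, (((A i).card * (B i).card * (C i).card : ℕ) : ℝ) ^ ((2 + ε) / 3)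
      ≤ ∑ _i ∈ S, q ^ ((m : ℝ) * ((2 + ε) / 3)) := Finset.sum_le_sum fun i _ => hterm i
    _ = S.card * q ^ ((m : ℝ) * ((2 + ε) / 3)) := by rw [Finset.sum_const, nsmul_eq_mul]
    _ ≤ 2 * q ^ ((m : ℝ) * ((2 + ε) / 3)) := by gcongr
    _ ≤ q ^ θ * q ^ ((m : ℝ) * ((2 + ε) / 3)) := by gcongr
    _ = q ^ (m : ℝ) := by rw [← Real.rpow_add hqpos, hθ]; ring_nf
    _ = q ^ m := Real.rpow_natCast q m

/-! ## §3b The numerology lemma behind the census (formal) -/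

/-- **Sparse families are admissible.**  If a finite family of non-negative weights has at most
`K q^e` non-zero members, each at most `L q^v`, and `e + v(2+ε)/3 < m` (a positive GAP), then
`Σ w_i^{(2+ε)/3} ≤ q^m` for all `q ≥ q₀(K, L, e, v, ε, m)`.  This is the arithmetic of §4: a design
with `N ≍ q^e` blocks of weight `≍ q^v` can violate the crux inequality at exponent `(2+ε)/3` only
if `ε ≥ ε⋆ = 3(m − e)/v − 2`.  (`fullFrameDesigns_admissible` is the case `K = 2, e = 0, v = m`,
`L = 1`; punctured lines are `K = 14, e = m − 3, v = 3` by `IsSTPP.lineFamily_card_bound`.) -/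
theorem sum_rpow_le_of_sparse {K L e v ε : ℝ} {m : ℕ} (hK : 0 < K) (hL : 0 < L) (hε : 0 ≤ ε)
    (hgap : e + v * ((2 + ε) / 3) < m) :
    ∃ q₀ : ℕ, ∀ q : ℕ, q₀ ≤ q → ∀ {ι : Type} (s : Finset ι) (w : ι → ℝ),
      (∀ i ∈ s, 0 ≤ w i) → (∀ i ∈ s, w i ≤ L * (q : ℝ) ^ v) →
      ((s.filter fun i => w i ≠ 0).card : ℝ) ≤ K * (q : ℝ) ^ e →
      ∑ i ∈ s, (w i) ^ ((2 + ε) / 3) ≤ (q : ℝ) ^ m := by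
  set g : ℝ := m - (e + v * ((2 + ε) / 3)) with hg
  have hgpos : 0 < g := by rw [hg]; linarith
  set Cst : ℝ := K * L ^ ((2 + ε) / 3) with hCst
  have hCpos : 0 < Cst := by rw [hCst]; positivity
  refine ⟨max 1 (Nat.ceil (Cst ^ (1 / g))), ?_⟩
  intro q hq ι s w hw0 hwle hcard
  classical
  have hq1 : (1 : ℝ) ≤ q := by exact_mod_cast le_trans (le_max_left _ _) hq
  have hqpos : (0 : ℝ) < q := by linarith
  have hexp : (0 : ℝ) < (2 + ε) / 3 := by linarith
  -- `Cst ≤ q^g`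
  have hCq : Cst ≤ (q : ℝ) ^ g := by
    have h1 : Cst ^ (1 / g) ≤ q := by
      have : (Nat.ceil (Cst ^ (1 / g)) : ℝ) ≤ q := by
        exact_mod_cast le_trans (le_max_right _ _) hq
      exact le_trans (Nat.le_ceil _) this
    calc Cst = (Cst ^ (1 / g)) ^ g := by
          rw [← Real.rpow_mul hCpos.le, one_div, inv_mul_cancel₀ hgpos.ne', Real.rpow_one]
      _ ≤ (q : ℝ) ^ g := Real.rpow_le_rpow (by positivity) h1 hgpos.le
  -- restrict the sum to the non-zero weights
  set s' := s.filter fun i => w i ≠ 0 with hs'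
  have hsum : ∑ i ∈ s, (w i) ^ ((2 + ε) / 3) = ∑ i ∈ s', (w i) ^ ((2 + ε) / 3) := by
    rw [hs', Finset.sum_filter_of_ne]
    intro i _ hne h0
    rw [h0, Real.zero_rpow hexp.ne'] at hne
    exact hne rfl
  -- each term at most `(L q^v)^{(2+ε)/3} = L^{(2+ε)/3} q^{v(2+ε)/3}`
  have hterm : ∀ i ∈ s', (w i) ^ ((2 + ε) / 3) ≤
      L ^ ((2 + ε) / 3) * (q : ℝ) ^ (v * ((2 + ε) / 3)) := by
    intro i hi
    have his : i ∈ s := (Finset.mem_filter.1 (hs' ▸ hi)).1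
    calc (w i) ^ ((2 + ε) / 3) ≤ (L * (q : ℝ) ^ v) ^ ((2 + ε) / 3) :=
          Real.rpow_le_rpow (hw0 i his) (hwle i his) hexp.le
      _ = L ^ ((2 + ε) / 3) * (q : ℝ) ^ (v * ((2 + ε) / 3)) := by
          rw [Real.mul_rpow hL.le (by positivity), ← Real.rpow_mul hqpos.le]
  rw [hsum]
  calc ∑ i ∈ s', (w i) ^ ((2 + ε) / 3)
      ≤ ∑ _i ∈ s', L ^ ((2 + ε) / 3) * (q : ℝ) ^ (v * ((2 + ε) / 3)) :=
        Finset.sum_le_sum hterm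
    _ = s'.card * (L ^ ((2 + ε) / 3) * (q : ℝ) ^ (v * ((2 + ε) / 3))) := by
        rw [Finset.sum_const, nsmul_eq_mul]
    _ ≤ (K * (q : ℝ) ^ e) * (L ^ ((2 + ε) / 3) * (q : ℝ) ^ (v * ((2 + ε) / 3))) := by
        gcongr
    _ = Cst * (q : ℝ) ^ (e + v * ((2 + ε) / 3)) := by
        rw [hCst, Real.rpow_add hqpos]; ring
    _ ≤ (q : ℝ) ^ g * (q : ℝ) ^ (e + v * ((2 + ε) / 3)) := by gcongr
    _ = (q : ℝ) ^ (m : ℝ) := by rw [← Real.rpow_add hqpos, hg]; ring_nf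
    _ = (q : ℝ) ^ m := Real.rpow_natCast _ m

/-! ## §4 Census: where a certificate below `ε = 1` could still live (for ideators and provers)

Write `q = |F|`.  A family with `N ≍ q^e` blocks of weight `|A||B||C| ≍ q^v` violates the crux
inequality at exponent `(2+ε)/3` for large `q` iff `e + v(2+ε)/3 > m`, i.e. iff
`ε > ε⋆ := 3(m − e)/v − 2`.  "Certifying `ε₀`" below means `ε⋆ < ε₀`, so that `DDB` restricted to that
family fails at every `ε > ε⋆` (gen 1: `DefinableDesignBarrierAt`).  For DEFINABLE families `e` and the
block dimensions are integers and the multiplicities `μ` are from a finite menu (CDM, tree fact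
`Literature.ModelTheory.PseudofiniteFields.ChatzidakisVanDenDriesMacintyre1992_mainTheorem`), so the
numerologies below are exhaustive up to the constants `μ`.

(a) FULL FRAMES (`v = m`, punctured subspaces): NOTHING below `ε = 1` (§2–§3: at most two full
    blocks, each of weight `< q^m`); `ε = 1` itself fails (gen 1 `false_at_one`, the definable CKSU
    two-block family, `2(q−1)^3 > q^3`).  Dead in particular: `(m; d,d,d)` with `m = 3d` and any
    `e ≥ 1`, including gen 1's "(6,2,1) ↦ 1/2".

(b) NON-FULL FRAMES (`v = d_A + d_B + d_C < m`, `N ≍ q^e`): sub-1 needs `e ≥ m − v + 1`; packing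
    (BCCGNSU Lemma 2.4, tree `AddSimultaneousTPP.sum_card_mul_card_le`) needs `e ≤ m − v + min d`.
    With `e = m − v + j`, `1 ≤ j ≤ min d`: `ε⋆ = 1 − 3j/v`.
    * lines `(1,1,1)`: only `j = 1`, `ε⋆ = 0` — exact or nothing, and exact line designs are REFUTED
      (`ExactLineDesign`, stmt-9732: Lean refutations by cdisprove-7622 and cruxidea-9732-2 on the
      ledger; `Literature/…/STPPLineFamilies`: `N (q−1)²(q+1) + 7 < 7 q^m`).  So punctured LINES
      certify nothing below `ε = 1` either.
    * cheapest surviving frame numerologies: `(m; 2,1,1; e = m−3)`, `m ≥ 5` ↦ `ε⋆ = 1/4`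
      (tight in the two pairings containing the plane); `(m; 2,2,1)` or `(m; 3,1,1)`, `e = m − 4`,
      `m ≥ 6` ↦ `2/5`; `(m; 2,2,2; e = m − 5)`, `m ≥ 7` ↦ `1/2` (tight in NO pairing; `m = 6` is full,
      dead by (a)).  `FrameBarrier_holds` (evidence on stmt-7620, `ε_m = 1/(2m)`) bounds from the
      other side; whether ANY frame family certifies some `ε < 1` is open — none is known, and every
      closed case has `O(1)` positive-weight blocks.

(c) BOUNDED-SIZE BLOCKS (any sets, any finite abelian group): `N` blocks of type `(a,a,a)` give
    `R(⊕_N ⟨a,a,a⟩) ≤ |H|` (CKSU Thm 5.3 in rank form, tree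
    `tensorRank_matMulDirectSum_le_card_of_isSTPP`) while Alder–Strassen (BCS Thm 17.14; tree named
    fact `AlderStrassen1981_rank`, matrix case proved in `MatMulRankLowerBounds*`) gives
    `R(⊕_N ⟨a,a,a⟩) = R(Mat_a^{×N}) ≥ 2a²N − N`.  Hence `N ≤ |H|/(2a² − 1)` and such blocks certify
    `ε` only if `a^{2+ε} > 2a² − 1`, i.e. `ε > ε_a := log_a (2 − a^{−2})`:
    `ε_2 ≈ 0.807, ε_3 ≈ 0.579, ε_4 ≈ 0.478, ε_5 ≈ 0.410, ε_10 ≈ 0.299, ε_a ∼ log 2 / log a`.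
    So a definable family whose block sizes stay `≤ C` certifies nothing at or below `ε_C`; small
    `ε` needs blocks of size `→ ∞`, which for definable families means size `≥ μ q` in at least one
    of `A, B, C` (CDM: sizes are `μ q^d + O(q^{d−1/2})`, `d ∈ ℕ`) — this is where the geometry
    (Lang–Weil / Kowalski Fourier decay / the cards on this item) must take over.  (Not formalised
    here: needs Alder–Strassen for `Mat_a^{×N}`, i.e. `numMaximalTwoSidedIdeals = N`.)

(d) CURVED FULL-WEIGHT BLOCKS — the one place §2 does not reach.  Rigidity uses linearity
    (`(V+W) ∩ (W+U) = W`).  A definable block of weight `|A||B||C| ≥ c q^m` that is NOT a frame (a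
    near-tiling `A + B + C ↪ F^m` by definable sets of dimensions `(d_A,d_B,d_C)`, `Σ d = m`) escapes
    it formally.  First numerologies where curved blocks could beat frames: `Θ(q)` full-weight blocks of
    dimension type `(1,1,1)` in `F^3` (EXACT ⇒ `ω = 2` by §0; frames: `≤ 2` blocks, §2b) and `Θ(q)`
    blocks of type `(2,1,1)` in `F^4` (`ε⋆ = 1/4`; frames: `≤ 2` blocks since `(2,1,1)` is full in
    `F^4`).  The pattern `(i,i,k)` reads `(A_i − C_i + (B_i − B_i)) ∩ (A_k − C_k) = ∅` for `k ≠ i`, with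
    `|A_i − C_i| = |A_i||C_i| ≍ q^m/|B_i|` by the TPP; if `B_i − B_i` expands `A_i − C_i` to almost all
    of `F^m` (as it does when `B_i` is far from a coset), block `i` alone kills every other block —
    this is the quantitative content the route's conjectural "coset step" must supply, and the natural
    first target for a `kit` census (small `p`, `m = 3`: curves `A_x, B_x, C_x` of degree ≤ 2).
    MIXED linear × curved blocks (cylinders `Y × L`, `Y` curved, `L` a punctured subspace) are the
    intermediate class: not frames (so §2 is silent) and WITHOUT Fourier decay in `≍ q^{m−k}`
    directions — Kowalski 2007 (arXiv:math/0504316) Thm 14(2)/Cor 16, read pp. 15–16: square-root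
    cancellation `S ≪ p^{δ−1/2}` holds UNLESS the phase is constant on a proportion `≥ η` of the
    definable set, and for linear phases `⟨h,·⟩` the exceptional `h` number `≤ D p^{n−1}` exactly when
    a piece `Φ_i` lies in an affine subspace (p. 16).  Any Fourier-decay line for the crux (card
    difference-set-fourier-decay on this item) must therefore treat cylinders separately; products of
    a frame family and a curved family are STPP (tree `AddSimultaneousTPP.prod`) and have
    `ε⋆(product)` between the factors' `ε⋆`, so they certify nothing new, but non-product mixed
    designs are not excluded by anything in this file.

(e) Everything certifying `ε → 0` proves `ω(ℂ) = 2` (§0); everything in (b)–(d) would moreover be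
    the first STPP design in an abelian group of bounded rank beating `ε = 1` at power level.
-/

end Summit.MatrixMultiplication.MatrixMultiplication.Cruxes.DefinableDesignBarrier.Disproof
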